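import Summits.QuantumFields.YangMills.Theorems.LuscherReductionTwistedTraceScalingConstTube
import Summits.QuantumFields.YangMills.Theorems.FemtoTransferGapAdjoint
import HarnessLib

/-!
# The ORTHOGRAPHIC constant-mode tube: `U_e = chartSU2(v_e) · u_{dir e}` with BALANCED vector parts `Σ_x v_{(x,k)} = 0` — injectivity, equivariance,
# and the explicit range criterion (the slow variable is the polar mean of the links of each direction)
# (lane A of S-BASE, crux `TwistedTraceScaling` stmt-QuantumFields-20203, sub-target C4 INNER; design note `pub/ym-fleet/ym-luscher-20007-p1/COARSE-DESIGN.md` §23)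

Companion of `…ConstTube` (gnomonic tube) in lane B's native coordinates: the transverse coordinate of a link is its VECTOR PART relative to the slow
link, `v_e = (U_e u_k⁻¹)⃗` (tree `vecPart`, `linkVec`; inverse chart `chartSU2`, `chartSU2_vecPart` of `…FemtoTransferGapAdjoint`), so that «balanced»
(`Σ_x v_{(x,k)} = 0`) is literally `dirMean (linkVec (U · constLift u⁻¹)) = 0` of `…LinkSpaceSplit`, and the EXACT Pythagoras
`norm_sub_sq_eq_mean_add_fluc` splits the kinetic exponent into one-site part + fluctuation part with NO cross term.
* `orthoTube L u v`, `(orthoTube L u v)_e = chartSU2 (v e) · u (0, dir e)`; `orthoTube_mul` (equivariance: `orthoTube L (u·w) v = orthoTube L u v · constLift L w`);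
  jointly continuous / measurable.
* ★★ `orthoTube_injective` on `(one-site) × capBalancedSet` (`capBalancedSet L` = balanced `v` with `|v_e|² ≤ 1/4`, a closed set): summing the unit quaternions
  of the links of direction `k` gives `(Σ_x √(1−|v_{(x,k)}|²)) · q(u_k)` — a POSITIVE REAL multiple of `q(u_k)` by balance — so `u_k` is the polar part of
  `Σ_x q(U_{(x,k)})`, determined by `U`; then `v_e = (U_e u_k⁻¹)⃗`.
* `mem_range_orthoTube` — the explicit range criterion: `U` is in the tube as soon as SOME one-site `u` makes the relative links `U_e u_k⁻¹` lie in the cap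
  (`(U_e u_k⁻¹)₀ ≥ 0`, `|(U_e u_k⁻¹)⃗|² ≤ 1/4`) with balanced vector parts.
With `…SlowDisintegration` (`integral_configMeasure_slowChart`, any equivariant continuous injective chart on a Polish parameter space) this chart carries
the EXACT disintegration `σ^{⊗E} = σ^{⊗3} ⊗ π`: the slow variable `u` is integrated against ONE-SITE Haar with no Jacobian.
HONEST FRAMING: elementary algebra for a stub of a child of the CONDITIONAL reduction route R2b1; no kernel estimate; C4 OPEN; not infinite volume, not a
gap, not Clay.
-/

set_option autoImplicit false

noncomputable section

open MeasureTheory Filter Topology Real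
open scoped BigOperators Matrix Quaternion
open Literature.MathematicalPhysics.QuantumFieldTheory
open Literature.MathematicalPhysics.QuantumLattice

namespace Summit.QuantumFields.YangMills.Theorems.FemtoTransferGap.TwoLattice.ConstTube

open Summit.QuantumFields.YangMills.Theorems.FemtoTransferGap

variable (L : ℕ) [NeZero L]

/-! ## §1 The orthographic tube map -/

/-- **Capped balanced vector coordinates**: `v : Edge → ℝ³` balanced (`Σ_x v_{(x,k)} = 0`) with every `|v_e|² ≤ 1/4` (upper cap of the link sphere).
[folklore] -/
def capBalancedSet : Set (Edge 3 L → Fin 3 → ℝ) := {v | v ∈ balancedSet L ∧ ∀ e : Edge 3 L, ∑ a, v e a ^ 2 ≤ 1 / 4}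

/-- The capped balanced set is closed. [folklore] -/
theorem isClosed_capBalancedSet : IsClosed (capBalancedSet L) := by
  have h : capBalancedSet L = balancedSet L ∩ ⋂ e : Edge 3 L, {v : Edge 3 L → Fin 3 → ℝ | ∑ a, v e a ^ 2 ≤ 1 / 4} := by
    ext v; simp [capBalancedSet]
  rw [h]
  refine (isClosed_balancedSet L).inter (isClosed_iInter fun e => ?_)
  exact isClosed_le (continuous_finsetSum _ fun a _ => ((continuous_apply a).comp (continuous_apply e)).pow 2) continuous_const

/-- The capped balanced set is measurable. [folklore] -/
theorem measurableSet_capBalancedSet : MeasurableSet (capBalancedSet L) := (isClosed_capBalancedSet L).measurableSet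

/-- `0` is capped balanced. [folklore] -/
theorem zero_mem_capBalancedSet : (0 : Edge 3 L → Fin 3 → ℝ) ∈ capBalancedSet L :=
  ⟨zero_mem_balancedSet L, fun e => by simp⟩

omit [NeZero L] in
/-- On the cap, `Σ_a v_e a² ≤ 1`. [folklore] -/
theorem sum_sq_le_one_of_cap {v : Edge 3 L → Fin 3 → ℝ} (hv : ∀ e : Edge 3 L, ∑ a, v e a ^ 2 ≤ 1 / 4) (e : Edge 3 L) : ∑ a, v e a ^ 2 ≤ 1 :=
  (hv e).trans (by norm_num)

/-- **The orthographic tube map**: `(orthoTube L u v)_e = chartSU2 (v e) · u (0, dir e)` — the upper-hemisphere link with vector part `v_e`, times the slow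
link of its direction. [cite: Luscher1983, §3] -/
def orthoTube (u : GaugeConfig 3 1 SU2) (v : Edge 3 L → Fin 3 → ℝ) : GaugeConfig 3 L SU2 :=
  fun e => chartSU2 (v e) * u (0, e.2)

omit [NeZero L] in
/-- Links of the orthographic tube map. [folklore] -/
@[simp] theorem orthoTube_apply (u : GaugeConfig 3 1 SU2) (v : Edge 3 L → Fin 3 → ℝ) (e : Edge 3 L) :
    orthoTube L u v e = chartSU2 (v e) * u (0, e.2) := rfl

omit [NeZero L] in
/-- The orthographic tube map is the orthographic step times the constant lift. [folklore] -/
theorem orthoTube_eq_mul_constLift (u : GaugeConfig 3 1 SU2) (v : Edge 3 L → Fin 3 → ℝ) :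
    orthoTube L u v = (fun e => chartSU2 (v e)) * constLift L u := by
  funext e; simp [orthoTube, constLift]

omit [NeZero L] in
/-- ★ Equivariance: `orthoTube L (u·w) v = orthoTube L u v · constLift L w`. [folklore] -/
theorem orthoTube_mul (u w : GaugeConfig 3 1 SU2) (v : Edge 3 L → Fin 3 → ℝ) :
    orthoTube L (u * w) v = orthoTube L u v * constLift L w := by
  funext e; simp [orthoTube, constLift, mul_assoc]

omit [NeZero L] in
/-- The relative links of the tube map: `(orthoTube L u v)_e · u_k⁻¹ = chartSU2 (v e)`. [folklore] -/
theorem orthoTube_mul_inv (u : GaugeConfig 3 1 SU2) (v : Edge 3 L → Fin 3 → ℝ) (e : Edge 3 L) :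
    orthoTube L u v e * (u (0, e.2))⁻¹ = chartSU2 (v e) := by
  simp [orthoTube, mul_assoc]

omit [NeZero L] in
/-- The orthographic tube map is jointly continuous. [folklore] -/
theorem continuous_orthoTube : Continuous fun p : GaugeConfig 3 1 SU2 × (Edge 3 L → Fin 3 → ℝ) => orthoTube L p.1 p.2 := by
  refine continuous_pi fun e => ?_
  simp only [orthoTube]
  exact ((continuous_chartSU2.comp ((continuous_apply e).comp continuous_snd)).mul ((continuous_apply _).comp continuous_fst))

omit [NeZero L] in
/-- The orthographic tube map is jointly measurable. [folklore] -/
theorem measurable_orthoTube : Measurable fun p : GaugeConfig 3 1 SU2 × (Edge 3 L → Fin 3 → ℝ) => orthoTube L p.1 p.2 := by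
  haveI : SecondCountableTopology SU2 := secondCountableTopology_su2
  refine measurable_pi_lambda _ fun e => ?_
  simp only [orthoTube]
  exact (continuous_chartSU2.measurable.comp ((measurable_pi_apply e).comp measurable_snd)).mul
    ((measurable_pi_apply _).comp measurable_fst)

omit [NeZero L] in
/-- For fixed `v`, `u ↦ orthoTube L u v` is measurable. [folklore] -/
theorem measurable_orthoTube_left (v : Edge 3 L → Fin 3 → ℝ) : Measurable fun u : GaugeConfig 3 1 SU2 => orthoTube L u v := by
  refine measurable_pi_lambda _ fun e => ?_
  simp only [orthoTube]
  exact measurable_const.mul (measurable_pi_apply _)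

/-! ## §2 Injectivity: the slow link is the polar part of the quaternion sum of its direction -/

/-- The sum of the chart quaternions of a balanced capped family in direction `k` is the positive real `Σ_x √(1 − |v_{(x,k)}|²)`. [folklore] -/
theorem sum_chartQuat_eq_coe {v : Edge 3 L → Fin 3 → ℝ} (hv : v ∈ capBalancedSet L) (k : Fin 3) :
    ∑ x : Site 3 L, chartQuat (v (x, k)) = ((∑ x : Site 3 L, √(1 - ∑ a, v (x, k) a ^ 2) : ℝ) : ℍ) := by
  obtain ⟨hb, _⟩ := hv
  ext
  · rw [show (∑ x : Site 3 L, chartQuat (v (x, k))).re = QuaternionAlgebra.reₗ _ _ _ (∑ x : Site 3 L, chartQuat (v (x, k))) from rfl, map_sum]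
    simp [chartQuat, QuaternionAlgebra.reₗ]
  · rw [show (∑ x : Site 3 L, chartQuat (v (x, k))).imI = QuaternionAlgebra.imIₗ _ _ _ (∑ x : Site 3 L, chartQuat (v (x, k))) from rfl, map_sum]
    simp [chartQuat, QuaternionAlgebra.imIₗ, hb k 0]
  · rw [show (∑ x : Site 3 L, chartQuat (v (x, k))).imJ = QuaternionAlgebra.imJₗ _ _ _ (∑ x : Site 3 L, chartQuat (v (x, k))) from rfl, map_sum]
    simp [chartQuat, QuaternionAlgebra.imJₗ, hb k 1]
  · rw [show (∑ x : Site 3 L, chartQuat (v (x, k))).imK = QuaternionAlgebra.imKₗ _ _ _ (∑ x : Site 3 L, chartQuat (v (x, k))) from rfl, map_sum]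
    simp [chartQuat, QuaternionAlgebra.imKₗ, hb k 2]

/-- The real sum `Σ_x √(1 − |v_{(x,k)}|²)` is positive on the cap. [folklore] -/
theorem sum_sqrt_pos {v : Edge 3 L → Fin 3 → ℝ} (hv : v ∈ capBalancedSet L) (k : Fin 3) : 0 < ∑ x : Site 3 L, √(1 - ∑ a, v (x, k) a ^ 2) := by
  refine Finset.sum_pos (fun x _ => Real.sqrt_pos.mpr ?_) Finset.univ_nonempty
  have := hv.2 (x, k); linarith

/-- ★★ **INJECTIVITY of the orthographic tube map on capped balanced coordinates.** [folklore] -/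
theorem orthoTube_injective {u u' : GaugeConfig 3 1 SU2} {v v' : Edge 3 L → Fin 3 → ℝ} (hv : v ∈ capBalancedSet L) (hv' : v' ∈ capBalancedSet L)
    (h : orthoTube L u v = orthoTube L u' v') : u = u' ∧ v = v' := by
  have hu : u = u' := by
    refine oneSite_ext fun k => ?_
    -- quaternion identity per site, then summed over the sites of direction `k`
    have hq : ∀ x : Site 3 L, chartQuat (v (x, k)) * su2Quat (u (0, k)) = chartQuat (v' (x, k)) * su2Quat (u' (0, k)) := fun x => by
      have he := congrArg su2Quat (congrFun h (x, k))
      simp only [orthoTube_apply, su2Quat_mul] at he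
      rwa [su2Quat_chartSU2 (sum_sq_le_one_of_cap L hv.2 (x, k)), su2Quat_chartSU2 (sum_sq_le_one_of_cap L hv'.2 (x, k))] at he
    have hsum : (∑ x : Site 3 L, chartQuat (v (x, k))) * su2Quat (u (0, k)) = (∑ x : Site 3 L, chartQuat (v' (x, k))) * su2Quat (u' (0, k)) := by
      rw [Finset.sum_mul, Finset.sum_mul]; exact Finset.sum_congr rfl fun x _ => hq x
    rw [sum_chartQuat_eq_coe L hv k, sum_chartQuat_eq_coe L hv' k] at hsum
    set r := ∑ x : Site 3 L, √(1 - ∑ a, v (x, k) a ^ 2) with hr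
    set r' := ∑ x : Site 3 L, √(1 - ∑ a, v' (x, k) a ^ 2) with hr'
    have hr0 : 0 < r := sum_sqrt_pos L hv k
    have hr'0 : 0 < r' := sum_sqrt_pos L hv' k
    -- norms: `r = r'`
    have hn := congrArg Quaternion.normSq hsum
    rw [map_mul, map_mul, Quaternion.normSq_coe, Quaternion.normSq_coe, normSq_su2Quat, normSq_su2Quat, mul_one, mul_one] at hn
    have hrr : r = r' := by nlinarith
    rw [← hrr] at hsum
    have hr_ne : (r : ℍ) ≠ 0 := by
      intro h0; exact hr0.ne' (Quaternion.coe_injective (by rw [h0, Quaternion.coe_zero]))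
    exact eq_of_su2Quat_eq (mul_left_cancel₀ hr_ne hsum)
  refine ⟨hu, ?_⟩
  funext e
  have he := congrFun h e
  rw [orthoTube_apply, orthoTube_apply, hu] at he
  have hc : chartSU2 (v e) = chartSU2 (v' e) := mul_right_cancel he
  have h1 := vecPart_chartSU2 (sum_sq_le_one_of_cap L hv.2 e)
  have h2 := vecPart_chartSU2 (sum_sq_le_one_of_cap L hv'.2 e)
  rw [← h1, ← h2, hc]

/-! ## §3 The range: explicit criterion -/

/-- **The orthographic tube**: the image of the orthographic tube map on capped balanced coordinates. [folklore] -/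
def orthoTubeSet : Set (GaugeConfig 3 L SU2) := {U | ∃ u : GaugeConfig 3 1 SU2, ∃ v ∈ capBalancedSet L, orthoTube L u v = U}

/-- Points of the tube. [folklore] -/
theorem orthoTube_mem (u : GaugeConfig 3 1 SU2) {v : Edge 3 L → Fin 3 → ℝ} (hv : v ∈ capBalancedSet L) : orthoTube L u v ∈ orthoTubeSet L :=
  ⟨u, v, hv, rfl⟩

/-- ★ **Explicit range criterion**: if for SOME one-site configuration `u` every relative link `U_e u_k⁻¹` lies in the upper cap (`(U_e u_k⁻¹)₀ ≥ 0`,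
`|(U_e u_k⁻¹)⃗|² ≤ 1/4`) and the vector parts are balanced (`Σ_x (U_{(x,k)} u_k⁻¹)⃗ = 0`), then `U = orthoTube L u v` with `v_e = (U_e u_k⁻¹)⃗`, so `U` lies in
the tube. (The natural `u` is the polar part of `Σ_x q(U_{(x,k)})`, for which the balance is automatic.) [folklore] -/
theorem mem_orthoTubeSet_of (U : GaugeConfig 3 L SU2) (u : GaugeConfig 3 1 SU2)
    (h0 : ∀ e : Edge 3 L, 0 ≤ scalarPart (U e * (u (0, e.2))⁻¹)) (hcap : ∀ e : Edge 3 L, ∑ a, vecPart (U e * (u (0, e.2))⁻¹) a ^ 2 ≤ 1 / 4)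
    (hbal : ∀ (k : Fin 3) (a : Fin 3), ∑ x : Site 3 L, vecPart (U (x, k) * (u (0, k))⁻¹) a = 0) :
    orthoTube L u (fun e => vecPart (U e * (u (0, e.2))⁻¹)) = U ∧ U ∈ orthoTubeSet L := by
  have hv : (fun e => vecPart (U e * (u (0, e.2))⁻¹)) ∈ capBalancedSet L := ⟨fun k a => hbal k a, fun e => hcap e⟩
  have hU : orthoTube L u (fun e => vecPart (U e * (u (0, e.2))⁻¹)) = U := by
    funext e
    rw [orthoTube_apply, chartSU2_vecPart _ (h0 e), inv_mul_cancel_right]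
  exact ⟨hU, hU ▸ orthoTube_mem L u hv⟩

end Summit.QuantumFields.YangMills.Theorems.FemtoTransferGap.TwoLattice.ConstTube

end
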